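import Literature.Analysis.Calculus.HadamardSndParam
import HarnessLib

/-!
# Hadamard's lemma of first order with parameters, and the rescaling `(s, u) ↦ s⁻¹ g(p, s u)`
# of a fibre map tangent to the identity

Topic `Literature/Analysis/Calculus`, continuing `HadamardLemma.lean` / `HadamardSndParam.lean`
(the analytic input of the Morse-lemma cluster of `Literature/Topology/FourManifolds`).  Written
for the patching step of the parametric Morse lemma along a circle (Morse–Bott lemma near a
nondegenerate critical circle: Banyaga–Hurtubise 2004; Hirsch, *Differential Topology* (1976),
Ch. 6 §1): two fibrewise Morse coordinate systems for the same family differ by a fibre map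
`g (p, ·)` preserving the model quadratic form `Q`, and when `g (p, ·)` is tangent to the identity
the **rescaled maps** `u ↦ s⁻¹ g (p, s u)`, `s ∈ [0, 1]`, join `g (p, ·)` (`s = 1`) to the identity
(`s = 0`) through `Q`-preserving maps (`Q` is homogeneous of degree two), smoothly in `(s, p, u)` —
the "Alexander trick" for germs.  Everything here is **proved**; no definition, no named fact.

* `exists_contDiff_fibreLinearPart` — **first-order Hadamard lemma in the fibre, with
  parameters**: for `C^∞` `g : P × E → G` there is a `C^∞` field of linear maps
  `B (p, u) : E →L G` with `g (p, u) = g (p, 0) + B (p, u) u` and `B (p, 0) = ∂ᵤ g (p, 0)`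
  (`B (p, u) = ∫₀¹ ∂ᵤ g (p, s u) ds`, smooth by differentiation under the integral sign,
  `contDiff_intervalIntegral`).
* `exists_contDiff_rescaling` — **the rescaled family**: for `C^∞` `g : P × E → E` with
  `g (p, 0) = 0` and `∂ᵤ g (p, 0) = id` there is a `C^∞` map `G : (ℝ × P) × E → E` with
  `G ((s, p), u) = s⁻¹ g (p, s u)` for `s ≠ 0`, `G ((0, p), u) = u`, `G ((1, p), u) = g (p, u)`,
  `G ((s, p), 0) = 0` and `∂ᵤ G ((s, p), 0) = id` for all `s`.
* `rescaling_apply_eq_of_homogeneous` — if a degree-two homogeneous `Q : E → ℝ` is preserved by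
  `g (p, ·)` on a ball `B(0, r)`, it is preserved by `G ((s, p), ·)` on `B(0, r)` for `|s| ≤ 1`.

## References

* A. Banyaga, D. E. Hurtubise, *A proof of the Morse–Bott Lemma*, Expo. Math. 22 (2004),
  365–373. [BanyagaHurtubise2004]
* M. W. Hirsch, *Differential Topology*, GTM 33 (1976), Ch. 6 §1, proof of Thm. 1.1.
  [HirschDT1976]
* J. Milnor, *Morse theory* (1963), Lemma 2.1. [Milnor1963]
-/

noncomputable section

-- Instance search through towers of continuous linear maps needs one more level of pending
-- depth, as in `HadamardLemma.lean`.
set_option maxSynthPendingDepth 2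

open Set Function Filter MeasureTheory intervalIntegral Metric
open scoped Topology ContDiff

namespace Literature.Analysis.Calculus

variable {P : Type*} [NormedAddCommGroup P] [NormedSpace ℝ P] [FiniteDimensional ℝ P]
  {E : Type*} [NormedAddCommGroup E] [NormedSpace ℝ E] [FiniteDimensional ℝ E]
  {G : Type*} [NormedAddCommGroup G] [NormedSpace ℝ G] [CompleteSpace G]

/-! ### Hadamard's lemma of first order in the fibre, with parameters -/

/-- **Hadamard's lemma of first order in the fibre, with parameters.**  For a `C^∞` map
`g : P × E → G` (finite-dimensional `P`, `E`; complete `G`) there is a `C^∞` field of continuous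
linear maps `B (p, u) : E →L[ℝ] G` with `g (p, u) = g (p, 0) + B (p, u) u` for all `(p, u)` and
`B (p, 0) = ∂ᵤ g (p, 0) = Dg (p, 0) ∘ inr`.  Take `B (p, u) = ∫₀¹ Dg (p, s u) ∘ inr ds`
(fundamental theorem of calculus along the fibre ray `s ↦ (p, s u)`; smoothness by
differentiation under the integral sign, `contDiff_intervalIntegral`).
[cite: Milnor1963, Lemma 2.1] [cite: HirschDT1976, Ch. 6 §1, proof of Thm. 1.1] -/
theorem exists_contDiff_fibreLinearPart {g : P × E → G} (hg : ContDiff ℝ ∞ g) :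
    ∃ B : P × E → (E →L[ℝ] G), ContDiff ℝ ∞ B ∧
      (∀ p u, g (p, u) = g (p, 0) + B (p, u) u) ∧
      ∀ p, B (p, 0) = (fderiv ℝ g (p, 0)).comp (ContinuousLinearMap.inr ℝ P E) := by
  -- the integrand `F (p, u) s = Dg (p, s u) ∘ inr`
  set Φ : ((P × E) →L[ℝ] G) →L[ℝ] (E →L[ℝ] G) :=
    (ContinuousLinearMap.compL ℝ E (P × E) G).flip (ContinuousLinearMap.inr ℝ P E) with hΦ
  have hΦapply : ∀ L : (P × E) →L[ℝ] G, Φ L = L.comp (ContinuousLinearMap.inr ℝ P E) :=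
    fun L => by simp [hΦ]
  set F : (P × E) → ℝ → (E →L[ℝ] G) := fun q s => Φ (fderiv ℝ g (q.1, s • q.2)) with hF
  have hray : ContDiff ℝ ∞ fun z : (P × E) × ℝ => ((z.1.1, z.2 • z.1.2) : P × E) := by fun_prop
  have hDg : ContDiff ℝ ∞ (fderiv ℝ g) := hg.fderiv_right (by simp)
  have hFs : ContDiff ℝ ∞ (uncurry F) := by
    have : uncurry F = fun z : (P × E) × ℝ => Φ (fderiv ℝ g (z.1.1, z.2 • z.1.2)) := by
      funext z; rfl
    rw [this]
    exact Φ.contDiff.comp (hDg.comp hray)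
  refine ⟨fun q => ∫ s in (0 : ℝ)..1, F q s, contDiff_intervalIntegral hFs 0 1, fun p u => ?_,
    fun p => ?_⟩
  · -- fundamental theorem of calculus along `s ↦ g (p, s u)`
    have hdiff : ∀ q, DifferentiableAt ℝ g q := fun q => hg.contDiffAt.differentiableAt (by simp)
    have hderiv : ∀ s : ℝ, HasDerivAt (fun s : ℝ => g (p, s • u)) (F (p, u) s u) s := fun s => by
      have h1 : HasDerivAt (fun s : ℝ => ((p, s • u) : P × E)) ((0 : P), u) s := by
        have hu : HasDerivAt (fun s : ℝ => s • u) u s := by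
          simpa using (hasDerivAt_id s).smul_const u
        exact (hasDerivAt_const s p).prodMk hu
      have h2 := (hdiff (p, s • u)).hasFDerivAt.comp_hasDerivAt s h1
      have heq : fderiv ℝ g (p, s • u) ((0 : P), u) = F (p, u) s u := by
        simp only [hF, hΦapply, ContinuousLinearMap.comp_apply, ContinuousLinearMap.inr_apply]
      rw [← heq]
      exact h2
    have hcont : Continuous fun s : ℝ => F (p, u) s :=
      hFs.continuous.comp (Continuous.prodMk_right (p, u))
    have hint : IntervalIntegrable (fun s : ℝ => F (p, u) s) volume 0 1 :=
      hcont.intervalIntegrable 0 1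
    have hint' : IntervalIntegrable (fun s : ℝ => F (p, u) s u) volume 0 1 :=
      (hcont.clm_apply continuous_const).intervalIntegrable 0 1
    have hftc := integral_eq_sub_of_hasDerivAt (fun s _ => hderiv s) hint'
    simp only [one_smul, zero_smul] at hftc
    rw [ContinuousLinearMap.intervalIntegral_apply hint u, hftc]
    abel
  · -- at `u = 0` the integrand is constant
    have : (fun s : ℝ => F (p, (0 : E)) s) = fun _ =>
        (fderiv ℝ g (p, 0)).comp (ContinuousLinearMap.inr ℝ P E) := by
      funext s
      simp only [hF, smul_zero, hΦapply]
    simp only [this, intervalIntegral.integral_const, sub_zero, one_smul]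

/-! ### The rescaled family of a fibre map tangent to the identity -/

/-- **The rescaling of a fibre map tangent to the identity.**  Let `g : P × E → E` be `C^∞` with
`g (p, 0) = 0` and `∂ᵤ g (p, 0) = id` for all `p`.  Then there is a `C^∞` map
`G : (ℝ × P) × E → E` with `G ((s, p), u) = s⁻¹ • g (p, s • u)` for `s ≠ 0` and
`G ((0, p), u) = u`; moreover `G ((1, p), u) = g (p, u)`, `G ((s, p), 0) = 0` and
`∂ᵤ G ((s, p), 0) = id` for every `s`.  With the first-order Hadamard form `B` of
`exists_contDiff_fibreLinearPart`, `G ((s, p), u) = B (p, s • u) u`. [cite: HirschDT1976, Ch. 6 §1]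
[cite: BanyagaHurtubise2004] -/
theorem exists_contDiff_rescaling {g : P × E → E} (hg : ContDiff ℝ ∞ g) (h0 : ∀ p, g (p, 0) = 0)
    (h1 : ∀ p, (fderiv ℝ g (p, 0)).comp (ContinuousLinearMap.inr ℝ P E) =
      ContinuousLinearMap.id ℝ E) :
    ∃ G : (ℝ × P) × E → E, ContDiff ℝ ∞ G ∧
      (∀ (s : ℝ) (p : P) (u : E), s ≠ 0 → G ((s, p), u) = s⁻¹ • g (p, s • u)) ∧
      (∀ (p : P) (u : E), G ((0, p), u) = u) ∧
      (∀ (p : P) (u : E), G ((1, p), u) = g (p, u)) ∧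
      (∀ (s : ℝ) (p : P), G ((s, p), 0) = 0) ∧
      ∀ (s : ℝ) (p : P), (fderiv ℝ G ((s, p), 0)).comp (ContinuousLinearMap.inr ℝ (ℝ × P) E) =
        ContinuousLinearMap.id ℝ E := by
  obtain ⟨B, hBs, hgB, hB0⟩ := exists_contDiff_fibreLinearPart hg
  have hB0' : ∀ p, B (p, 0) = ContinuousLinearMap.id ℝ E := fun p => by rw [hB0, h1]
  set G : (ℝ × P) × E → E := fun z => B (z.1.2, z.1.1 • z.2) z.2 with hG
  have harg : ContDiff ℝ ∞ fun z : (ℝ × P) × E => ((z.1.2, z.1.1 • z.2) : P × E) := by fun_prop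
  have hGs : ContDiff ℝ ∞ G := (hBs.comp harg).clm_apply contDiff_snd
  have hformula : ∀ (s : ℝ) (p : P) (u : E), s ≠ 0 → G ((s, p), u) = s⁻¹ • g (p, s • u) := by
    intro s p u hs
    have := hgB p (s • u)
    rw [h0, zero_add, map_smul] at this
    rw [this, smul_smul, inv_mul_cancel₀ hs, one_smul]
  have hzero : ∀ (p : P) (u : E), G ((0, p), u) = u := fun p u => by
    simp only [hG, zero_smul, hB0', ContinuousLinearMap.id_apply]
  refine ⟨G, hGs, hformula, hzero, fun p u => ?_, fun s p => ?_, fun s p => ?_⟩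
  · rw [hformula 1 p u one_ne_zero, inv_one, one_smul, one_smul]
  · simp only [hG, smul_zero, map_zero]
  · -- the fibre derivative at `u = 0`
    have hdiff : DifferentiableAt ℝ G ((s, p), 0) := hGs.contDiffAt.differentiableAt (by simp)
    rw [← fderiv_partial_snd hdiff]
    -- `u ↦ B (p, s • u) u` has derivative `B (p, 0) = id` at `0`
    have hc : HasFDerivAt (fun u : E => B (p, s • u))
        (fderiv ℝ (fun u : E => B (p, s • u)) 0) 0 := by
      have : ContDiff ℝ ∞ fun u : E => B (p, s • u) := hBs.comp (by fun_prop)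
      exact (this.contDiffAt.differentiableAt (by simp)).hasFDerivAt
    have hu : HasFDerivAt (fun u : E => u) (ContinuousLinearMap.id ℝ E) (0 : E) := hasFDerivAt_id 0
    have key := hc.clm_apply hu
    simp only [smul_zero, map_zero] at key
    have hfun : (fun u : E => G ((s, p), u)) = fun u : E => B (p, s • u) u := by
      funext u; rfl
    rw [hfun, key.fderiv, hB0', ContinuousLinearMap.id_comp]
    simp

omit [NormedAddCommGroup P] [NormedSpace ℝ P] [FiniteDimensional ℝ P] [FiniteDimensional ℝ E] in
/-- **Rescaling preserves an invariant homogeneous quadratic function.**  In the situation of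
`exists_contDiff_rescaling`, if `Q : E → ℝ` is homogeneous of degree two and `g (p, ·)` preserves
`Q` on the ball `B(0, r)`, then every rescaled map `G ((s, p), ·)`, `|s| ≤ 1`, preserves `Q` on
`B(0, r)`: `Q (s⁻¹ g (p, s u)) = s⁻² Q (g (p, s u)) = s⁻² Q (s u) = Q u`. [folklore] -/
theorem rescaling_apply_eq_of_homogeneous {g : P × E → E} {G : (ℝ × P) × E → E}
    (hGg : ∀ (s : ℝ) (p : P) (u : E), s ≠ 0 → G ((s, p), u) = s⁻¹ • g (p, s • u))
    (hG0 : ∀ (p : P) (u : E), G ((0, p), u) = u)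
    {Q : E → ℝ} (hQ : ∀ (c : ℝ) (v : E), Q (c • v) = c ^ 2 * Q v) {r : ℝ} {p : P}
    (hgQ : ∀ u ∈ ball (0 : E) r, Q (g (p, u)) = Q u) {s : ℝ} (hs : |s| ≤ 1) {u : E}
    (hu : u ∈ ball (0 : E) r) : Q (G ((s, p), u)) = Q u := by
  by_cases hs0 : s = 0
  · rw [hs0, hG0]
  · have hsu : s • u ∈ ball (0 : E) r := by
      rw [mem_ball_zero_iff] at hu ⊢
      calc ‖s • u‖ = |s| * ‖u‖ := norm_smul s u
        _ ≤ 1 * ‖u‖ := by gcongr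
        _ < r := by rw [one_mul]; exact hu
    rw [hGg s p u hs0, hQ, hgQ _ hsu, hQ, inv_pow]
    field_simp

end Literature.Analysis.Calculus
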